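import Literature.Analysis.PDE.HeatZeroEnergy
import Literature.Analysis.PDE.TimeExtension
import HarnessLib

/-!
# Uniqueness for the heat equation on a closed time slab (topic `Analysis/PDE`)

Analytic layer of the programme to prove short-time existence for quasilinear strictly
parabolic systems on a closed manifold (hypothesis `hQL` of
`Literature.Geometry.Riemannian.ricciFlow_shortTime_existence_of_quasilinear`). The a priori
estimates of that programme are obtained patch by patch: the cut-off chart expression
`w = χ̂ v̂` of a solution `v` of a linear parabolic system solves, on the closed slab
`[0, T] × E`, the flat equation `∂ₜw = νΔw + Θ`, `w(0) = 0`, with a slab-smooth compactly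
supported right-hand side `Θ`; to feed `w` into the weighted energy estimates of the
zero-initial-value Duhamel solution (`HeatZeroEnergy.lean`) one needs to know that `w` IS that
solution. This file proves the **uniqueness theorem** that does this
(`eq_heatDuhamelZero_of_slab`): a function `w : ℝ → E → F'` which is smooth on the closed
slab `[0, T] × E`, vanishes off a fixed compact set in space and at `t = 0`, and satisfies
`∂ₜw = νΔw + Θ` on `[0, T]` (one-sided at the ends) for a space–time test field `Θ`, coincides
on `[0, T]` with `heatDuhamelZero ν Θ`.

The proof is the energy method (Evans, §2.3.4, Thm. 10; §7.1.2, Thm. 4): the difference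
`d = w - v` solves the homogeneous equation with `d(0) = 0`, and
`‖d(t)‖₂² = 2ν ∫₀ᵗ ∫⟪d, Δd⟫ = -2ν ∫₀ᵗ Σᵢ ‖∂ᵢd‖₂² ≤ 0`. Technically `w` is first replaced by
its smooth compactly supported extension in time (`slabExtend`, `TimeExtension.lean`), so that
`d` is the difference of a test field and a zero-initial-value Duhamel field, for which joint
integrability on slabs and the boundary-free integration by parts are available.

Everything is proved; no named fact and no `sorry` is introduced.

## References

* L. C. Evans, *Partial Differential Equations*, 2nd ed., AMS 2010, §2.3.4, Thm. 10
  (uniqueness for the heat equation by the energy method) and §7.1.2, Thm. 4. [Evans2010]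
-/

noncomputable section

open MeasureTheory Set Function Filter Topology TopologicalSpace Metric InnerProductSpace
open scoped RealInnerProductSpace Laplacian ContDiff ENNReal

namespace Literature.Analysis.PDE

open Literature.Analysis.UnboundedOperators Literature.Analysis.FluidPDE
  Literature.Analysis.FunctionSpaces

variable {E : Type*} [NormedAddCommGroup E] [InnerProductSpace ℝ E] [FiniteDimensional ℝ E]
  [MeasurableSpace E] [BorelSpace E]
variable {F' : Type*} [NormedAddCommGroup F'] [InnerProductSpace ℝ F'] [FiniteDimensional ℝ F']

variable {ν : ℝ} {Θ₁ Θ₂ Θ₃ Θ₄ : ℝ → E → F'}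

/-! ### Differences of a test field and a zero-initial-value Duhamel field -/

section Difference

/-- Slices of `Θ₁ - v[Θ₂]` are bounded, uniformly below a time. [folklore] -/
theorem exists_norm_test_sub_heatDuhamelZero_le (hΘ₁ : IsSpaceTimeTestOn (⊤ : Opens (ℝ × E)) Θ₁)
    (hΘ₂ : IsSpaceTimeTestOn (⊤ : Opens (ℝ × E)) Θ₂) (hν : 0 < ν) (T : ℝ) :
    ∃ C : ℝ, ∀ t, t ≤ T → ∀ x, ‖Θ₁ t x - heatDuhamelZero ν Θ₂ t x‖ ≤ C := by
  obtain ⟨M, _, hM⟩ := hΘ₁.exists_norm_le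
  obtain ⟨C, hC⟩ := exists_norm_heatDuhamelZero_le hΘ₂ hν T
  exact ⟨M + C, fun t ht x ↦ (norm_sub_le _ _).trans (add_le_add (hM t x) (hC t ht x))⟩

/-- Slices of `Θ₁ - v[Θ₂]` are integrable. [folklore] -/
theorem integrable_test_sub_heatDuhamelZero (hΘ₁ : IsSpaceTimeTestOn (⊤ : Opens (ℝ × E)) Θ₁)
    (hΘ₂ : IsSpaceTimeTestOn (⊤ : Opens (ℝ × E)) Θ₂) (hν : 0 < ν) (t : ℝ) :
    Integrable (fun x ↦ Θ₁ t x - heatDuhamelZero ν Θ₂ t x) volume :=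
  ((hΘ₁.contDiff_slice t).continuous.integrable_of_hasCompactSupport
    (hΘ₁.hasCompactSupport_slice t)).sub (integrable_heatDuhamelZero hΘ₂ hν t)

/-- Uniform `L¹` bound below a time for the slices of `Θ₁ - v[Θ₂]`. [folklore] -/
theorem exists_integral_norm_test_sub_heatDuhamelZero_le
    (hΘ₁ : IsSpaceTimeTestOn (⊤ : Opens (ℝ × E)) Θ₁)
    (hΘ₂ : IsSpaceTimeTestOn (⊤ : Opens (ℝ × E)) Θ₂) (hν : 0 < ν) (T : ℝ) :
    ∃ C : ℝ, ∀ t, t ≤ T → ∫ x, ‖Θ₁ t x - heatDuhamelZero ν Θ₂ t x‖ ≤ C := by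
  obtain ⟨M₁, _, hM₁⟩ := hΘ₁.exists_integral_norm_slice_le
  obtain ⟨C, hC⟩ := exists_integral_norm_heatDuhamelZero_le hΘ₂ hν T
  refine ⟨M₁ + C, fun t ht ↦ ?_⟩
  have h1 : Integrable (Θ₁ t) volume :=
    (hΘ₁.contDiff_slice t).continuous.integrable_of_hasCompactSupport
      (hΘ₁.hasCompactSupport_slice t)
  have h2 := integrable_heatDuhamelZero hΘ₂ hν t
  calc ∫ x, ‖Θ₁ t x - heatDuhamelZero ν Θ₂ t x‖
      ≤ ∫ x, ‖Θ₁ t x‖ + ‖heatDuhamelZero ν Θ₂ t x‖ :=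
        integral_mono (h1.sub h2).norm (h1.norm.add h2.norm) fun x ↦ norm_sub_le _ _
    _ = (∫ x, ‖Θ₁ t x‖) + ∫ x, ‖heatDuhamelZero ν Θ₂ t x‖ := integral_add h1.norm h2.norm
    _ ≤ M₁ + C := add_le_add (hM₁ t) (hC t ht)

/-- Slices of `Θ₁ - v[Θ₂]` are continuous. [folklore] -/
theorem continuous_test_sub_heatDuhamelZero (hΘ₁ : IsSpaceTimeTestOn (⊤ : Opens (ℝ × E)) Θ₁)
    (hΘ₂ : IsSpaceTimeTestOn (⊤ : Opens (ℝ × E)) Θ₂) (hν : 0 < ν) (t : ℝ) :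
    Continuous fun x ↦ Θ₁ t x - heatDuhamelZero ν Θ₂ t x :=
  (hΘ₁.contDiff_slice t).continuous.sub (continuous_heatDuhamelZero_space hΘ₂ hν t)

/-- `Θ₁ - v[Θ₂]` is jointly continuous. [folklore] -/
theorem continuous_uncurry_test_sub_heatDuhamelZero
    (hΘ₁ : IsSpaceTimeTestOn (⊤ : Opens (ℝ × E)) Θ₁)
    (hΘ₂ : IsSpaceTimeTestOn (⊤ : Opens (ℝ × E)) Θ₂) (hν : 0 < ν) :
    Continuous (uncurry fun t x ↦ Θ₁ t x - heatDuhamelZero ν Θ₂ t x) :=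
  hΘ₁.continuous_uncurry.sub (continuous_uncurry_heatDuhamelZero hΘ₂ hν)

/-- Pairings of two such differences are integrable in `x`. [folklore] -/
theorem integrable_inner_test_sub_heatDuhamelZero
    (hΘ₁ : IsSpaceTimeTestOn (⊤ : Opens (ℝ × E)) Θ₁) (hΘ₂ : IsSpaceTimeTestOn (⊤ : Opens (ℝ × E)) Θ₂)
    (hΘ₃ : IsSpaceTimeTestOn (⊤ : Opens (ℝ × E)) Θ₃) (hΘ₄ : IsSpaceTimeTestOn (⊤ : Opens (ℝ × E)) Θ₄)
    (hν : 0 < ν) (s : ℝ) :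
    Integrable (fun x ↦ ⟪Θ₁ s x - heatDuhamelZero ν Θ₂ s x,
      Θ₃ s x - heatDuhamelZero ν Θ₄ s x⟫) volume := by
  obtain ⟨C, hC⟩ := exists_norm_test_sub_heatDuhamelZero_le hΘ₁ hΘ₂ hν s
  exact integrable_inner_of_norm_le (continuous_test_sub_heatDuhamelZero hΘ₁ hΘ₂ hν s)
    (hC s le_rfl) (integrable_test_sub_heatDuhamelZero hΘ₃ hΘ₄ hν s)

/-- **Joint integrability of the pairing of two such differences on a slab `E × (0, T]`.**
[folklore] -/
theorem integrable_prod_inner_test_sub_heatDuhamelZero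
    (hΘ₁ : IsSpaceTimeTestOn (⊤ : Opens (ℝ × E)) Θ₁) (hΘ₂ : IsSpaceTimeTestOn (⊤ : Opens (ℝ × E)) Θ₂)
    (hΘ₃ : IsSpaceTimeTestOn (⊤ : Opens (ℝ × E)) Θ₃) (hΘ₄ : IsSpaceTimeTestOn (⊤ : Opens (ℝ × E)) Θ₄)
    (hν : 0 < ν) (T : ℝ) :
    Integrable (fun q : E × ℝ ↦ ⟪Θ₁ q.2 q.1 - heatDuhamelZero ν Θ₂ q.2 q.1,
        Θ₃ q.2 q.1 - heatDuhamelZero ν Θ₄ q.2 q.1⟫)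
      ((volume : Measure E).prod (volume.restrict (Ioc 0 T))) := by
  obtain ⟨C₀, hC₀⟩ := exists_norm_test_sub_heatDuhamelZero_le hΘ₁ hΘ₂ hν T
  obtain ⟨C₁, hC₁⟩ := exists_integral_norm_test_sub_heatDuhamelZero_le hΘ₃ hΘ₄ hν T
  set U : ℝ → E → F' := fun s x ↦ Θ₁ (min s T) x - heatDuhamelZero ν Θ₂ (min s T) x with hU
  set G : ℝ → E → F' := fun s x ↦ Θ₃ (min s T) x - heatDuhamelZero ν Θ₄ (min s T) x with hG
  have hmin : Continuous fun s : ℝ ↦ min s T := continuous_id.min continuous_const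
  have hUc : Continuous (uncurry U) :=
    (continuous_uncurry_test_sub_heatDuhamelZero hΘ₁ hΘ₂ hν).comp
      ((hmin.comp continuous_fst).prodMk continuous_snd)
  have hGc : Continuous (uncurry G) :=
    (continuous_uncurry_test_sub_heatDuhamelZero hΘ₃ hΘ₄ hν).comp
      ((hmin.comp continuous_fst).prodMk continuous_snd)
  have hUb : ∀ s x, ‖U s x‖ ≤ C₀ := fun s x ↦ hC₀ _ (min_le_right _ _) x
  have hGi : ∀ s, Integrable (G s) volume := fun s ↦
    integrable_test_sub_heatDuhamelZero hΘ₃ hΘ₄ hν _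
  have hGb : ∀ s, ∫ x, ‖G s x‖ ≤ C₁ := fun s ↦ hC₁ _ (min_le_right _ _)
  have h := integrable_prod_inner_of_bound hUc hGc hUb hGi hGb 0 T
  refine h.congr ?_
  have hS : ∀ᵐ q ∂((volume : Measure E).prod (volume.restrict (Ioc 0 T))), q.2 ∈ Ioc 0 T :=
    (Measure.quasiMeasurePreserving_snd (μ := (volume : Measure E))
      (ν := volume.restrict (Ioc 0 T))).ae (ae_restrict_mem measurableSet_Ioc)
  filter_upwards [hS] with q hq
  simp only [hU, hG, min_eq_left hq.2]

/-- The derivative of a slice of `Θ₁ - v[Θ₂]` along `v` is the slice of `∂ᵥΘ₁ - v[∂ᵥΘ₂]`.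
[folklore] -/
theorem fderiv_test_sub_heatDuhamelZero_apply
    (hΘ₁ : IsSpaceTimeTestOn (⊤ : Opens (ℝ × E)) Θ₁) (hΘ₂ : IsSpaceTimeTestOn (⊤ : Opens (ℝ × E)) Θ₂)
    (hν : 0 < ν) (s : ℝ) (x v : E) :
    fderiv ℝ (fun y ↦ Θ₁ s y - heatDuhamelZero ν Θ₂ s y) x v =
      fderiv ℝ (Θ₁ s) x v - heatDuhamelZero ν (fun t y ↦ fderiv ℝ (Θ₂ t) y v) s x := by
  have h1 : DifferentiableAt ℝ (Θ₁ s) x :=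
    ((hΘ₁.contDiff_slice s).differentiable (by simp)) x
  have h2 : DifferentiableAt ℝ (heatDuhamelZero ν Θ₂ s) x :=
    ((contDiff_heatDuhamelZero hΘ₂ hν s).differentiable (by simp)) x
  rw [fderiv_fun_sub h1 h2, sub_apply, fderiv_heatDuhamelZero_apply hΘ₂ hν s x v]

/-- **Integration by parts between differences** (no boundary terms):
`∫⟪d, ∂ᵥ∂ᵥd⟫ = -∫⟪∂ᵥd, ∂ᵥd⟫` for `d = Θ₁(s) - v[Θ₂](s)`. [folklore] -/
theorem integral_inner_test_sub_heatDuhamelZero_fderiv_fderiv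
    (hΘ₁ : IsSpaceTimeTestOn (⊤ : Opens (ℝ × E)) Θ₁) (hΘ₂ : IsSpaceTimeTestOn (⊤ : Opens (ℝ × E)) Θ₂)
    (hν : 0 < ν) (s : ℝ) (v : E) :
    ∫ x, ⟪Θ₁ s x - heatDuhamelZero ν Θ₂ s x,
        fderiv ℝ (fun z ↦ fderiv ℝ (Θ₁ s) z v) x v -
          heatDuhamelZero ν (fun t y ↦ fderiv ℝ (fun z ↦ fderiv ℝ (Θ₂ t) z v) y v) s x⟫ =
      -∫ x, ⟪fderiv ℝ (Θ₁ s) x v - heatDuhamelZero ν (fun t y ↦ fderiv ℝ (Θ₂ t) y v) s x,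
        fderiv ℝ (Θ₁ s) x v - heatDuhamelZero ν (fun t y ↦ fderiv ℝ (Θ₂ t) y v) s x⟫ := by
  have hΘ₁v := hΘ₁.fderiv_apply_top v
  have hΘ₂v := hΘ₂.fderiv_apply_top v
  have hΘ₁vv := hΘ₁v.fderiv_apply_top v
  have hΘ₂vv := hΘ₂v.fderiv_apply_top v
  set f : E → F' := fun y ↦ Θ₁ s y - heatDuhamelZero ν Θ₂ s y with hf
  set g : E → F' := fun y ↦ fderiv ℝ (Θ₁ s) y v -
    heatDuhamelZero ν (fun t y ↦ fderiv ℝ (Θ₂ t) y v) s y with hg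
  have hfd : Differentiable ℝ f :=
    ((hΘ₁.contDiff_slice s).differentiable (by simp)).sub
      ((contDiff_heatDuhamelZero hΘ₂ hν s).differentiable (by simp))
  have hgd : Differentiable ℝ g :=
    ((hΘ₁v.contDiff_slice s).differentiable (by simp)).sub
      ((contDiff_heatDuhamelZero hΘ₂v hν s).differentiable (by simp))
  have hf'v : ∀ x, fderiv ℝ f x v =
      fderiv ℝ (Θ₁ s) x v - heatDuhamelZero ν (fun t y ↦ fderiv ℝ (Θ₂ t) y v) s x :=
    fun x ↦ fderiv_test_sub_heatDuhamelZero_apply hΘ₁ hΘ₂ hν s x v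
  have hg'v : ∀ x, fderiv ℝ g x v = fderiv ℝ (fun z ↦ fderiv ℝ (Θ₁ s) z v) x v -
      heatDuhamelZero ν (fun t y ↦ fderiv ℝ (fun z ↦ fderiv ℝ (Θ₂ t) z v) y v) s x :=
    fun x ↦ fderiv_test_sub_heatDuhamelZero_apply hΘ₁v hΘ₂v hν s x v
  have key := integral_bilinear_hasFDerivAt_right_eq_neg_left_of_integrable
    (μ := (volume : Measure E)) (B := innerSL ℝ (E := F')) (f := f) (f' := fderiv ℝ f) (g := g)
    (g' := fderiv ℝ g) (v := v) ?_ ?_ ?_ (fun x _ ↦ (hfd x).hasFDerivAt)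
    (fun x _ ↦ (hgd x).hasFDerivAt)
  · simp_rw [hg'v, hf'v] at key
    exact key
  · simp_rw [hf'v]
    exact integrable_inner_test_sub_heatDuhamelZero hΘ₁v hΘ₂v hΘ₁v hΘ₂v hν s
  · simp_rw [hg'v]
    exact integrable_inner_test_sub_heatDuhamelZero hΘ₁ hΘ₂ hΘ₁vv hΘ₂vv hν s
  · exact integrable_inner_test_sub_heatDuhamelZero hΘ₁ hΘ₂ hΘ₁v hΘ₂v hν s

/-- The Laplacian of a slice of `Θ₁ - v[Θ₂]` is the slice of `ΔΘ₁ - v[ΔΘ₂]`. [folklore] -/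
theorem laplacian_test_sub_heatDuhamelZero_apply
    (hΘ₁ : IsSpaceTimeTestOn (⊤ : Opens (ℝ × E)) Θ₁) (hΘ₂ : IsSpaceTimeTestOn (⊤ : Opens (ℝ × E)) Θ₂)
    (hν : 0 < ν) (s : ℝ) (x : E) :
    (Δ (fun y ↦ Θ₁ s y - heatDuhamelZero ν Θ₂ s y)) x =
      (Δ (Θ₁ s)) x - heatDuhamelZero ν (fun t ↦ Δ (Θ₂ t)) s x := by
  rw [laplacian_sub_apply ((hΘ₁.contDiff_slice s).of_le (by norm_cast))
    ((contDiff_heatDuhamelZero hΘ₂ hν s).of_le (by norm_cast)),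
    laplacian_heatDuhamelZero hΘ₂ hν s x]

/-- **`∫⟪d, Δd⟫ = -Σᵢ ∫‖∂ᵢd‖²` for `d = Θ₁(s) - v[Θ₂](s)`** (integration by parts in each
frame direction). [cite: Evans2010, §2.3.4, Thm. 10] -/
theorem integral_inner_laplacian_test_sub_heatDuhamelZero
    (hΘ₁ : IsSpaceTimeTestOn (⊤ : Opens (ℝ × E)) Θ₁) (hΘ₂ : IsSpaceTimeTestOn (⊤ : Opens (ℝ × E)) Θ₂)
    (hν : 0 < ν) (s : ℝ) :
    ∫ x, ⟪Θ₁ s x - heatDuhamelZero ν Θ₂ s x,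
        (Δ (fun y ↦ Θ₁ s y - heatDuhamelZero ν Θ₂ s y)) x⟫ =
      -∑ i, ∫ x, ‖fderiv ℝ (fun y ↦ Θ₁ s y - heatDuhamelZero ν Θ₂ s y) x
        (stdOrthonormalBasis ℝ E i)‖ ^ 2 := by
  set b := stdOrthonormalBasis ℝ E
  set f : E → F' := fun y ↦ Θ₁ s y - heatDuhamelZero ν Θ₂ s y with hf
  have hfs : ContDiff ℝ ∞ f := (hΘ₁.contDiff_slice s).sub (contDiff_heatDuhamelZero hΘ₂ hν s)
  have hi : ∀ i, IsSpaceTimeTestOn (⊤ : Opens (ℝ × E))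
      (fun t y ↦ fderiv ℝ (fun z ↦ fderiv ℝ (Θ₂ t) z (b i)) y (b i)) := fun i ↦
    (hΘ₂.fderiv_apply_top (b i)).fderiv_apply_top (b i)
  have hi₁ : ∀ i, IsSpaceTimeTestOn (⊤ : Opens (ℝ × E))
      (fun t y ↦ fderiv ℝ (fun z ↦ fderiv ℝ (Θ₁ t) z (b i)) y (b i)) := fun i ↦
    (hΘ₁.fderiv_apply_top (b i)).fderiv_apply_top (b i)
  -- the first derivatives of `f` along the frame
  have hf1 : ∀ i, (fun y ↦ fderiv ℝ f y (b i)) = fun y ↦ fderiv ℝ (Θ₁ s) y (b i) -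
      heatDuhamelZero ν (fun t y ↦ fderiv ℝ (Θ₂ t) y (b i)) s y := fun i ↦
    funext fun y ↦ fderiv_test_sub_heatDuhamelZero_apply hΘ₁ hΘ₂ hν s y (b i)
  -- `Δf = Σᵢ ∂ᵢ∂ᵢf`, each of the same form
  have hW : ∀ x, (Δ f) x = ∑ i, (fderiv ℝ (fun z ↦ fderiv ℝ (Θ₁ s) z (b i)) x (b i) -
      heatDuhamelZero ν (fun t y ↦ fderiv ℝ (fun z ↦ fderiv ℝ (Θ₂ t) z (b i)) y (b i)) s x) := by
    intro x
    rw [IsHeatAdmissible.laplacian_eq_sum hfs]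
    refine Finset.sum_congr rfl fun i _ ↦ ?_
    rw [hf1 i]
    exact fderiv_test_sub_heatDuhamelZero_apply (hΘ₁.fderiv_apply_top (b i))
      (hΘ₂.fderiv_apply_top (b i)) hν s x (b i)
  simp_rw [hW, inner_sum]
  rw [integral_finsetSum _ fun i _ ↦
    integrable_inner_test_sub_heatDuhamelZero hΘ₁ hΘ₂ (hi₁ i) (hi i) hν s,
    ← Finset.sum_neg_distrib]
  refine Finset.sum_congr rfl fun i _ ↦ ?_
  rw [integral_inner_test_sub_heatDuhamelZero_fderiv_fderiv hΘ₁ hΘ₂ hν s (b i)]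
  congr 1
  refine integral_congr_ae (Eventually.of_forall fun x ↦ ?_)
  dsimp only
  rw [← fderiv_test_sub_heatDuhamelZero_apply hΘ₁ hΘ₂ hν s x (b i), real_inner_self_eq_norm_sq]

end Difference

/-! ### The uniqueness theorem -/

section Unique

variable {Θ : ℝ → E → F'} {w : ℝ → E → F'} {T : ℝ} {K : Set E}

/-- **Uniqueness for the heat equation on a closed slab** (energy method): let
`w : ℝ → E → F'` be smooth on the closed slab `[0, T] × E` (`ContDiffOn` of the uncurried map
on `Icc 0 T ×ˢ univ`), vanish off a compact set `K` in space and at `t = 0`, and satisfy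
`∂ₜw = νΔw + Θ` on `[0, T]` (one-sided at the ends) for a space–time test field `Θ`. Then
`w = heatDuhamelZero ν Θ` on `[0, T]`. [cite: Evans2010, §2.3.4, Thm. 10] -/
theorem eq_heatDuhamelZero_of_slab (hT : 0 < T) (hν : 0 < ν)
    (hΘ : IsSpaceTimeTestOn (⊤ : Opens (ℝ × E)) Θ)
    (hw : ContDiffOn ℝ ∞ (uncurry w) (Icc 0 T ×ˢ univ)) (hK : IsCompact K)
    (hwK : ∀ s, ∀ x ∉ K, w s x = 0) (hw0 : ∀ x, w 0 x = 0)
    (hpde : ∀ t ∈ Icc 0 T, ∀ x,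
      HasDerivWithinAt (fun s ↦ w s x) (ν • (Δ (w t)) x + Θ t x) (Icc 0 T) t)
    {t : ℝ} (ht : t ∈ Icc 0 T) (x : E) : w t x = heatDuhamelZero ν Θ t x := by
  -- the smooth compactly supported extension of `w` in time (opaque name `W`)
  obtain ⟨W, hW⟩ : ∃ W : ℝ → E → F', W = slabExtend T w := ⟨_, rfl⟩
  have hWt : IsSpaceTimeTestOn (⊤ : Opens (ℝ × E)) W := by
    rw [hW]; exact isSpaceTimeTestOn_slabExtend hT hw hK hwK
  have hWeq : ∀ s ∈ Icc 0 T, W s = w s := fun s hs ↦ by rw [hW]; exact slabExtend_eq_of_mem hs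
  clear hW
  have hΘl : IsSpaceTimeTestOn (⊤ : Opens (ℝ × E)) (fun s ↦ Δ (Θ s)) := hΘ.laplacian_top
  have hWl : IsSpaceTimeTestOn (⊤ : Opens (ℝ × E)) (fun s ↦ Δ (W s)) := hWt.laplacian_top
  -- the difference `D = W - v[Θ]` and the Laplacian of its slices `L` (opaque names)
  obtain ⟨D, hD⟩ : ∃ D : ℝ → E → F', D = fun s y ↦ W s y - heatDuhamelZero ν Θ s y := ⟨_, rfl⟩
  obtain ⟨L, hL⟩ : ∃ L : ℝ → E → F',
      L = fun s y ↦ (Δ (W s)) y - heatDuhamelZero ν (fun r ↦ Δ (Θ r)) s y := ⟨_, rfl⟩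
  have hDs : ∀ s, D s = fun y ↦ W s y - heatDuhamelZero ν Θ s y := fun s ↦ by rw [hD]
  have hΔD : ∀ s y, (Δ (D s)) y = L s y := fun s y ↦ by
    rw [hDs s, hL]
    exact laplacian_test_sub_heatDuhamelZero_apply hWt hΘ hν s y
  have hcD : Continuous (uncurry D) := by
    rw [hD]; exact continuous_uncurry_test_sub_heatDuhamelZero hWt hΘ hν
  have hcL : Continuous (uncurry L) := by
    rw [hL]; exact continuous_uncurry_test_sub_heatDuhamelZero hWl hΘl hν
  -- Step 1: `D` solves the homogeneous heat equation on `[0, T]`, `D(0) = 0`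
  have hD0 : ∀ y, D 0 y = 0 := fun y ↦ by
    rw [hDs 0]
    simp only [heatDuhamelZero_zero, Pi.zero_apply, sub_zero]
    rw [hWeq 0 ⟨le_rfl, hT.le⟩]
    exact hw0 y
  have hd : ∀ s ∈ Icc 0 T, ∀ y, HasDerivWithinAt (fun r ↦ D r y) (ν • L s y) (Icc 0 T) s := by
    intro s hs y
    have h1 : HasDerivWithinAt (fun r ↦ W r y) (ν • (Δ (w s)) y + Θ s y) (Icc 0 T) s :=
      (hpde s hs y).congr (fun r hr ↦ by rw [hWeq r hr]) (by rw [hWeq s hs])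
    have h2 : HasDerivWithinAt (fun r ↦ heatDuhamelZero ν Θ r y)
        (ν • (Δ (heatDuhamelZero ν Θ s)) y + Θ s y) (Icc 0 T) s :=
      (hasDerivWithinAt_heatDuhamelZero hΘ hν hs.1 y).mono Icc_subset_Ici_self
    have h := h1.sub h2
    rw [hD, hL]
    refine h.congr_deriv ?_
    simp only
    rw [hWeq s hs, laplacian_heatDuhamelZero hΘ hν s y, smul_sub]
    abel
  -- Step 2: pointwise fundamental theorem of calculus
  have step2 : ∀ y, ∫ s in (0 : ℝ)..t, 2 * ⟪D s y, ν • L s y⟫ = ‖D t y‖ ^ 2 := by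
    intro y
    have hg : ∀ s ∈ Icc 0 T, HasDerivWithinAt (fun r ↦ ‖D r y‖ ^ 2) (2 * ⟪D s y, ν • L s y⟫)
        (Icc 0 T) s := fun s hs ↦ (hd s hs y).norm_sq
    have htT : Icc 0 t ⊆ Icc 0 T := Icc_subset_Icc_right ht.2
    have hcont : ContinuousOn (fun r ↦ ‖D r y‖ ^ 2) (Icc 0 t) := fun r hr ↦
      ((hg r (htT hr)).continuousWithinAt).mono htT
    have hderiv : ∀ r ∈ Ioo 0 t, HasDerivAt (fun r ↦ ‖D r y‖ ^ 2) (2 * ⟪D r y, ν • L r y⟫) r :=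
      fun r hr ↦ (hg r (htT (Ioo_subset_Icc_self hr))).hasDerivAt
        (Icc_mem_nhds hr.1 (hr.2.trans_le ht.2))
    have hc : Continuous fun s ↦ 2 * ⟪D s y, ν • L s y⟫ := by
      have hDy : Continuous fun s ↦ D s y := hcD.comp (continuous_id.prodMk continuous_const)
      have hLy : Continuous fun s ↦ L s y := hcL.comp (continuous_id.prodMk continuous_const)
      exact continuous_const.mul (hDy.inner (hLy.const_smul ν))
    rw [intervalIntegral.integral_eq_sub_of_hasDerivAt_of_le ht.1 hcont hderiv
      (hc.intervalIntegrable _ _), hD0 y]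
    simp
  -- Step 3: integrate in `x` and swap
  have hjoint : Integrable (fun q : E × ℝ ↦ 2 * ⟪D q.2 q.1, ν • L q.2 q.1⟫)
      ((volume : Measure E).prod (volume.restrict (Ioc 0 t))) := by
    have h := (integrable_prod_inner_test_sub_heatDuhamelZero hWt hΘ hWl hΘl hν t).const_mul
      (2 * ν)
    refine h.congr (Eventually.of_forall fun q ↦ ?_)
    simp only [hD, hL, real_inner_smul_right]
    ring
  have step3 : ∫ y, ‖D t y‖ ^ 2 = ∫ s in Ioc 0 t, ∫ y, 2 * ⟪D s y, ν • L s y⟫ := by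
    simp_rw [← step2, intervalIntegral.integral_of_le ht.1]
    exact integral_integral_swap (f := fun y s ↦ 2 * ⟪D s y, ν • L s y⟫) hjoint
  -- Step 4: the slices are nonpositive by integration by parts
  have step4 : ∀ s, ∫ y, 2 * ⟪D s y, ν • L s y⟫ ≤ 0 := by
    intro s
    have heq : (fun y ↦ 2 * ⟪D s y, ν • L s y⟫) = fun y ↦ (2 * ν) * ⟪D s y, (Δ (D s)) y⟫ := by
      funext y
      rw [hΔD s y, real_inner_smul_right]
      ring
    rw [heq, integral_const_mul]
    refine mul_nonpos_of_nonneg_of_nonpos (by positivity) ?_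
    have hibp := integral_inner_laplacian_test_sub_heatDuhamelZero hWt hΘ hν s
    simp only [hDs s]
    rw [hibp, neg_nonpos]
    exact Finset.sum_nonneg fun i _ ↦ integral_nonneg fun y ↦ sq_nonneg _
  -- Step 5: conclusion
  have hle : ∫ y, ‖D t y‖ ^ 2 ≤ 0 := by
    rw [step3]
    exact setIntegral_nonpos measurableSet_Ioc fun s _ ↦ step4 s
  have hint : Integrable (fun y ↦ ‖D t y‖ ^ 2) volume := by
    have h := integrable_inner_test_sub_heatDuhamelZero hWt hΘ hWt hΘ hν t
    refine h.congr (Eventually.of_forall fun y ↦ ?_)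
    simp only [hD]
    exact real_inner_self_eq_norm_sq _
  have hzero : (fun y ↦ ‖D t y‖ ^ 2) =ᵐ[volume] 0 :=
    (integral_eq_zero_iff_of_nonneg (fun y ↦ sq_nonneg _) hint).1
      (le_antisymm hle (integral_nonneg fun y ↦ sq_nonneg _))
  have hcont : Continuous fun y ↦ ‖D t y‖ ^ 2 := by
    rw [hDs t]
    exact ((continuous_test_sub_heatDuhamelZero hWt hΘ hν t).norm).pow 2
  have hall : (fun y ↦ ‖D t y‖ ^ 2) = 0 :=
    (Continuous.ae_eq_iff_eq volume hcont continuous_const).1 hzero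
  have hx : ‖D t x‖ ^ 2 = 0 := congr_fun hall x
  rw [hDs t] at hx
  simp only at hx
  rw [sq_eq_zero_iff, norm_eq_zero, sub_eq_zero, hWeq t ht] at hx
  exact hx

/-- Uniqueness, slice form: under the hypotheses of `eq_heatDuhamelZero_of_slab`,
`w t = heatDuhamelZero ν Θ t` for `t ∈ [0, T]`. [cite: Evans2010, §2.3.4, Thm. 10] -/
theorem slice_eq_heatDuhamelZero_of_slab (hT : 0 < T) (hν : 0 < ν)
    (hΘ : IsSpaceTimeTestOn (⊤ : Opens (ℝ × E)) Θ)
    (hw : ContDiffOn ℝ ∞ (uncurry w) (Icc 0 T ×ˢ univ)) (hK : IsCompact K)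
    (hwK : ∀ s, ∀ x ∉ K, w s x = 0) (hw0 : ∀ x, w 0 x = 0)
    (hpde : ∀ t ∈ Icc 0 T, ∀ x,
      HasDerivWithinAt (fun s ↦ w s x) (ν • (Δ (w t)) x + Θ t x) (Icc 0 T) t)
    {t : ℝ} (ht : t ∈ Icc 0 T) : w t = heatDuhamelZero ν Θ t :=
  funext fun x ↦ eq_heatDuhamelZero_of_slab hT hν hΘ hw hK hwK hw0 hpde ht x

end Unique

end Literature.Analysis.PDE

end
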